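import Summits.HodgeConjecture.HodgeConjecture.Theorems.Ring2AbelianAllAndreTwistedSquareSplitVsNonsplit
import Summits.HodgeConjecture.HodgeConjecture.Theorems.Ring2AbelianAllAndreTwistedSquareInhabitants
import Summits.HodgeConjecture.HodgeConjecture.Theorems.WeilTypeLadder
import Literature.AlgebraicGeometry.VanGeemen1994.HyperbolicOfSplitDiscriminant
import HarnessLib

/-!
# Ring 2 · AbelianAll — ANDRÉ AXIS, PART P-a: THE EVEN HALF OF PART O —
  for `dim T` EVEN every product-polarized twisted square `(T × T, φ × (−φ), L ⊠ L^{⊗m})` has discriminant class `1`, is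
  POLARIZED HYPERBOLIC, and lies on the split component ONLY; every twisted square (`dim T ≥ 2`) is absolutely split

HONEST FRAMING (sub-cell `pub-hodge-ring2-ab-*`, verbatim): research route, not a corollary; conditional on HC_CM plus
one named minimal statement. (Cell `pub-hodge-ring2`, verbatim: research route conditional on HC_CM; not a corollary;
Q11.4-sentence-2 already refuted in dim ≥ 3.) `HC_CM` does not occur in this file. No definition, no named fact, no `sorry`;
fact-free, ABELIAN-VARIETY level (no pencil). Inputs: parts O-a (`exists_hasWeilDiscriminantNondeg_twistedSquare`,
`isWeilType_twistedSquare`), O-d (`exists_ellipticPower_sq_eq_neg`), O-e (`isSplitWeilType_twistedSquare_of_odd`), the tree's Landherr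
converse on the carriers (`VanGeemen1994.isHyperbolicWeilType_of_hasWeilDiscriminantNondeg_split`) and uniqueness of the discriminant class
(`VanGeemen1994.hasWeilDiscriminantNondeg_ksymm_unique`), the algebraic Weil plane of a twisted square
(`weilClassesOf_twistedSquare_le_algebraicClasses`) and Deligne's `hodgeConjectureFor_powSucc_powSucc`.

PARITY LAW OF THE ANCHORS `T × T̄` (parts O-a/O-b and this file). Part O-a computed the van Geemen class of the weight-`m` Segre
polarization of the twisted square of a `g`-fold `T` with `φ² = −d`: `[(−m)^g] ∈ ℚˣ/Nm(K_dˣ)`. For `g` ODD this is `[−m]` — every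
NEGATIVE class, non-split ones included (part O-b). For `g` EVEN it is a rational SQUARE: the class is `1 = [(−1)^g]`, the SPLIT class.
This file draws the consequences:

* §1 `isHyperbolicWeilType_of_isWeilType_of_hasWeilDiscriminantNondeg_neg_one_pow` — the polarized Landherr converse packaged on `IsWeilType`
  (the rational non-zero `(n, n)` Weil class it needs is supplied by the Weil type; companion of the tree's absolute
  `IsWeilType.isSplitWeilType_of_hasWeilDiscriminantNondeg_split`).
* §2 **`exists_hyperbolic_polarized_twistedSquare_of_even`** — `dim T = 2j + 2`: ONE projective embedding `e_T` of `T` and, for EVERY weight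
  `m ≥ 1`, a projective embedding of `T × T` whose `K`-symmetrised class is `pr₁^*h_K + m·pr₂^*h_K`, carries a non-degenerate discriminant witness
  of class `1`, carries witnesses of NO OTHER class (the polarized twisted square lies on the component `(2j+2, d, 1)` and on no other), and for
  which `(T × T, φ × (−φ))` is of HYPERBOLIC Weil type (polarized split).
* §3 **`isSplitWeilType_twistedSquare_of_two_le_dim`** — EVERY twisted square `T × T̄` with `dim T ≥ 2` is of split Weil type in the absolute convention
  (even: §2; odd: part O-e), so the ladder's absolute predicate `IsNonsplitWeilType` FAILS at every twisted square
  (`not_isNonsplitWeilType_twistedSquare`): the anchors of this axis are never members of the rung `NonsplitSixfolds`' domain, in any dimension.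
* §4 **the split rungs hold AT the anchors**: the bodies of `WeilTypeLadder.SplitEightfolds` (at `A × Ā`, `A` any abelian FOURFOLD with
  `K`-multiplication, any signature) and of `WeilTypeLadder.SplitWeilAbelianVarieties` (at every `T × T̄`) hold outright — the Weil plane of a
  twisted square is algebraic (Schoen's graph argument, tree theorem); by §2 these anchors DO lie in the rungs' hyperbolic domain when `dim T` is even.
* §5 **`exists_hodge_hyperbolic_weilVariety_even`** — hypothesis-free: for every `j`, `d ≥ 1` a polarized HYPERBOLIC Weil `(4j+4)`-fold
  `E₀^{2j+2} × Ē₀^{2j+2}` of type `(2j+2, d)` with algebraic Weil plane satisfying the Hodge conjecture (the even companion of part O-d).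

HONEST REMARKS. Nothing here is a new case of the Hodge conjecture; §4 restates the tree's algebraicity of the Weil plane of a twisted square
in the literal shape of the rungs. For `g` even the product-polarized anchors reach ONLY the split component: the non-split components of even
half-dimension (`δ > 0`, `δ ≠ 1`) are NOT anchored by this construction (ab-weil-1's CM tower `weilComponent_cmAnchor` anchors them by products of CM
squares with DIFFERENT weights on the factors — not a twisted square with a product class `h_a ⊞ h_c`, `h_c = m·h_a`). Nothing minimal is claimed;
N104 untouched. Part P-b draws the pencil consequences (split pencils through `A × Ā`, `dim A` even, at one member).

## References

* [vanGeemen1994HodgeAV] B. van Geemen, LNM 1594 (1994), 4.9–4.10, 4.14, Lemma 5.2 (1)–(4), 5.3–5.4 and (5.4.1).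
* [Landherr1936HermitianForms] W. Landherr, Abh. Math. Sem. Hamburg 11 (1936) 245–248.
* [Deligne1982HodgeCycles] P. Deligne (notes by J. Milne), LNM 900 (1982), §4 Prop. 4.4, Cor. 4.2, Remark 4.10.
* [Markman2025SecantWeil] E. Markman, arXiv:2502.03415 (unrefereed), §1.2 (nothing in print for split `2n ≥ 8`).
* [Markman2025SurveySecant] E. Markman, arXiv:2509.23403 (unrefereed), §1.1, §11.5 Steps 1–2, §12.
* [Schoen1998HodgeWeilAddendum] C. Schoen, Compositio 114 (1998), §10. [Andre1996Motifs] Y. André, Publ. Math. IHÉS 83 (1996), §6.3.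
-/

set_option linter.dupNamespace false

noncomputable section

open CategoryTheory
open Literature.AlgebraicGeometry Literature.AlgebraicGeometry.Motives
open Literature.AlgebraicGeometry.HodgeTheory Literature.AlgebraicGeometry.VanGeemen1994
open Literature.AlgebraicTopology.SingularHomology
open Summit.HodgeConjecture.HodgeConjecture.WeilTypeLadder (SplitEightfolds SplitWeilAbelianVarieties)

namespace Summit.HodgeConjecture.HodgeConjecture.Ring2.AbelianAll

/-! ## §1 The polarized Landherr converse on a Weil-type pair -/

section Landherr

variable {A : AbelianVariety ℂ} {n d : ℕ} {φ : A ⟶ A}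

/-- **Polarized Landherr on a Weil-type pair**: if `(A, φ)` is of Weil type `(n, d)` and the `K`-symmetrised hyperplane class
`h_K = d·e^*a + φ^*e^*a` carries a non-degenerate discriminant witness of the split class `[(−1)ⁿ]`, then `(A, φ)` is HYPERBOLIC for `h_K`
(the tree's `isHyperbolicWeilType_of_hasWeilDiscriminantNondeg_split`, its rational non-zero `(n, n)` Weil class supplied by the Weil type,
van Geemen Lemma 5.2 (5)–(6)). [cite: vanGeemen1994HodgeAV, 4.9, 5.4 and (5.4.1)] [cite: Landherr1936HermitianForms]
[cite: Deligne1982HodgeCycles, §4 Cor. 4.2] -/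
theorem isHyperbolicWeilType_of_isWeilType_of_hasWeilDiscriminantNondeg_neg_one_pow (hW : IsWeilType A φ n d)
    (e : ProjectiveEmbedding A.X) {a : complexBetti (projectiveSpace e.n ℂ) 2} (ha : IsRationalClass a) (ha0 : a ≠ 0)
    (hδ : HasWeilDiscriminantNondeg A φ n d
      ((d : ℂ) • complexBetti.map e.ι 2 a + complexBetti.map φ.hom.hom.hom 2 (complexBetti.map e.ι 2 a))
      (QuotientGroup.mk ((-1 : ℚˣ) ^ n))) :
    IsHyperbolicWeilType A φ n ((d : ℂ) • complexBetti.map e.ι 2 a + complexBetti.map φ.hom.hom.hom 2 (complexBetti.map e.ι 2 a)) := by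
  obtain ⟨c, hcw, hc0, hcr⟩ := exists_isRationalClass_ne_zero_mem_weilClassesOf hW.pos hW.dim_eq hW.d_pos hW.sq_eq
  exact isHyperbolicWeilType_of_hasWeilDiscriminantNondeg_split hW.pos hW.dim_eq hW.d_pos hW.sq_eq e ha ha0
    ⟨c, hcw, hcr, hW.isOfHodgeType_of_mem_weilClassesOf hcw, hc0⟩ hδ

/-- The split class is the trivial class in EVEN half-dimension: `[(−1)^{2j+2}] = 1`. [cite: vanGeemen1994HodgeAV, 4.14 and (5.4.1)] -/
theorem weilNormResidueGroup_mk_neg_one_pow_even (d j : ℕ) :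
    (QuotientGroup.mk ((-1 : ℚˣ) ^ (2 * j + 2)) : weilNormResidueGroup d) = 1 := by
  rw [show (-1 : ℚˣ) ^ (2 * j + 2) = 1 from Even.neg_one_pow ⟨j + 1, by ring⟩, QuotientGroup.mk_one]

end Landherr

/-! ## §2 `dim T` even: discriminant class `1`, no other class, polarized hyperbolic -/

section Even

variable {T : AbelianVariety ℂ} {j d : ℕ} {φ : T ⟶ T}

/-- **THE EVEN HALF: THE PRODUCT-POLARIZED TWISTED SQUARE OF AN EVEN-DIMENSIONAL `T` IS POLARIZED SPLIT.** Let `dim T = 2j + 2`,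
`φ ≫ φ = −(d • 𝟙 T)`, `d ≥ 1`, `Φ = φ × (−φ)` on `T × T`. There is ONE projective embedding `e_T` of `T` with a non-zero rational ambient
class `a_T` (`h_K = d·e_T^*a_T + φ^*e_T^*a_T`) such that for EVERY weight `m ≥ 1` some projective embedding `e` of `T × T` with a rational
`a ≠ 0` has `K`-symmetrised class `d·e^*a + Φ^*e^*a = pr₁^*h_K + m·pr₂^*h_K` which (i) carries a non-degenerate discriminant witness of the
TRIVIAL class `1 ∈ ℚˣ/Nm(K_dˣ)` (part O-a: class `[(−m)^{2j+2}] = [((−m)^{j+1})²] = 1`), (ii) carries witnesses of NO other class (uniqueness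
of `det H` on the carriers, van Geemen Lemma 5.2 (3)) — so the polarized pair lies on the component `(2j+2, d, 1)` and on no other —, and
(iii) for which `(T × T, Φ)` is of HYPERBOLIC Weil type (`1 = [(−1)^{2j+2}]`, Weil type by part O-a, Landherr §1).
[cite: vanGeemen1994HodgeAV, Lemma 5.2 (2)–(4), 4.14, 5.3–5.4 and (5.4.1)] [cite: Landherr1936HermitianForms]
[cite: Markman2025SurveySecant, §11.5 Steps 1–2] -/
theorem exists_hyperbolic_polarized_twistedSquare_of_even (hT : T.dim = 2 * j + 2) (hd : 0 < d) (hφ : φ ≫ φ = -(d • 𝟙 T)) :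
    ∃ (eT : ProjectiveEmbedding T.X) (aT : complexBetti (projectiveSpace eT.n ℂ) 2),
      IsRationalClass aT ∧ aT ≠ 0 ∧
      ∀ m : ℕ, 0 < m →
        ∃ (e : ProjectiveEmbedding (T.prod T).X) (a : complexBetti (projectiveSpace e.n ℂ) 2),
          IsRationalClass a ∧ a ≠ 0 ∧
          (d : ℂ) • complexBetti.map e.ι 2 a +
              complexBetti.map (AbelianVariety.prodLift (AbelianVariety.fst T T ≫ φ)
                (AbelianVariety.snd T T ≫ (-φ))).hom.hom.hom 2 (complexBetti.map e.ι 2 a) =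
            complexBetti.map (AbelianVariety.fst T T).hom.hom.hom 2
                ((d : ℂ) • complexBetti.map eT.ι 2 aT + complexBetti.map φ.hom.hom.hom 2 (complexBetti.map eT.ι 2 aT)) +
              ((m : ℚ) : ℂ) • complexBetti.map (AbelianVariety.snd T T).hom.hom.hom 2
                ((d : ℂ) • complexBetti.map eT.ι 2 aT + complexBetti.map φ.hom.hom.hom 2 (complexBetti.map eT.ι 2 aT)) ∧
          HasWeilDiscriminantNondeg (T.prod T)
            (AbelianVariety.prodLift (AbelianVariety.fst T T ≫ φ) (AbelianVariety.snd T T ≫ (-φ))) (2 * j + 2) d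
            ((d : ℂ) • complexBetti.map e.ι 2 a +
              complexBetti.map (AbelianVariety.prodLift (AbelianVariety.fst T T ≫ φ)
                (AbelianVariety.snd T T ≫ (-φ))).hom.hom.hom 2 (complexBetti.map e.ι 2 a)) 1 ∧
          (∀ δ : weilNormResidueGroup d,
            HasWeilDiscriminantNondeg (T.prod T)
              (AbelianVariety.prodLift (AbelianVariety.fst T T ≫ φ) (AbelianVariety.snd T T ≫ (-φ))) (2 * j + 2) d
              ((d : ℂ) • complexBetti.map e.ι 2 a +
                complexBetti.map (AbelianVariety.prodLift (AbelianVariety.fst T T ≫ φ)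
                  (AbelianVariety.snd T T ≫ (-φ))).hom.hom.hom 2 (complexBetti.map e.ι 2 a)) δ → δ = 1) ∧
          IsHyperbolicWeilType (T.prod T)
            (AbelianVariety.prodLift (AbelianVariety.fst T T ≫ φ) (AbelianVariety.snd T T ≫ (-φ))) (2 * j + 2)
            ((d : ℂ) • complexBetti.map e.ι 2 a +
              complexBetti.map (AbelianVariety.prodLift (AbelianVariety.fst T T ≫ φ)
                (AbelianVariety.snd T T ≫ (-φ))).hom.hom.hom 2 (complexBetti.map e.ι 2 a)) := by
  have hT' : T.dim = (2 * j + 1) + 1 := by rw [hT]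
  have hW : IsWeilType (T.prod T)
      (AbelianVariety.prodLift (AbelianVariety.fst T T ≫ φ) (AbelianVariety.snd T T ≫ (-φ))) (2 * j + 2) d :=
    isWeilType_twistedSquare (by omega) hT hd hφ
  obtain ⟨eT, aT, haT, haT0, hemb⟩ := exists_hasWeilDiscriminantNondeg_twistedSquare (m₀ := 2 * j + 1) (by omega) hT' hd hφ
  refine ⟨eT, aT, haT, haT0, fun m hm ↦ ?_⟩
  obtain ⟨e, a, w, ha, ha0, hw, hcl, hδ⟩ := hemb m hm
  have hmQ : (m : ℚ) ≠ 0 := Nat.cast_ne_zero.2 hm.ne'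
  -- the class `[(−m)^{2j+2}] = 1`
  have h1 : (QuotientGroup.mk w : weilNormResidueGroup d) = 1 := by
    rw [← QuotientGroup.mk_one]
    refine weilNormResidueGroup_mk_eq_mk_of_val_eq ((-Units.mk0 (m : ℚ) hmQ) ^ (j + 1)) ?_
    rw [hw, Units.val_one, one_mul, Units.val_pow_eq_pow_val, Units.val_neg, Units.val_mk0, ← pow_mul,
      show 2 * j + 1 + 1 = (j + 1) * 2 by ring]
  rw [h1] at hδ
  refine ⟨e, a, ha, ha0, hcl, hδ, fun δ hδ' ↦ ?_, ?_⟩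
  · exact hasWeilDiscriminantNondeg_ksymm_unique hW.pos (dim_twistedSquare hT) hd (twistedSquare_comp_self hφ) e ha hδ' hδ
  · refine isHyperbolicWeilType_of_isWeilType_of_hasWeilDiscriminantNondeg_neg_one_pow hW e ha ha0 ?_
    rwa [weilNormResidueGroup_mk_neg_one_pow_even]

/-- **`T × T̄` with `dim T = 2j + 2` is of SPLIT Weil type `(2j+2, d)`** (absolute convention: some `K`-symmetrised hyperplane class is
hyperbolic — here already the weight-`1` product class). [cite: vanGeemen1994HodgeAV, Lemma 5.2 (3), 5.4 and (5.4.1)] [cite: Landherr1936HermitianForms] -/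
theorem isSplitWeilType_twistedSquare_of_even (hT : T.dim = 2 * j + 2) (hd : 0 < d) (hφ : φ ≫ φ = -(d • 𝟙 T)) :
    IsSplitWeilType (T.prod T)
      (AbelianVariety.prodLift (AbelianVariety.fst T T ≫ φ) (AbelianVariety.snd T T ≫ (-φ))) (2 * j + 2) d := by
  obtain ⟨eT, aT, -, -, hemb⟩ := exists_hyperbolic_polarized_twistedSquare_of_even hT hd hφ
  obtain ⟨e, a, ha, ha0, -, -, -, hhyp⟩ := hemb 1 one_pos
  exact ⟨isWeilType_twistedSquare (by omega) hT hd hφ, e, a, ha, ha0, hhyp⟩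

/-- … hence for `dim T` even the anchor `T × T̄` is NOT hyperbolic for NO product class: the weight-`m` classes are all hyperbolic, and a
`K`-symmetrised hyperplane class of `T × T̄` carrying a witness of a class `δ ≠ 1` is NOT hyperbolic (van Geemen (5.4.1) ⟹ on the carriers) —
recorded as the dichotomy used by part P-b. [cite: vanGeemen1994HodgeAV, Lemma 5.2 (3) and (5.4.1)] -/
theorem not_isHyperbolicWeilType_twistedSquare_of_ne_one (hT : T.dim = 2 * j + 2) (hd : 0 < d) (hφ : φ ≫ φ = -(d • 𝟙 T))
    (e : ProjectiveEmbedding (T.prod T).X) {a : complexBetti (projectiveSpace e.n ℂ) 2} (ha : IsRationalClass a) (ha0 : a ≠ 0)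
    {δ : weilNormResidueGroup d}
    (hδ : HasWeilDiscriminantNondeg (T.prod T)
      (AbelianVariety.prodLift (AbelianVariety.fst T T ≫ φ) (AbelianVariety.snd T T ≫ (-φ))) (2 * j + 2) d
      ((d : ℂ) • complexBetti.map e.ι 2 a +
        complexBetti.map (AbelianVariety.prodLift (AbelianVariety.fst T T ≫ φ)
          (AbelianVariety.snd T T ≫ (-φ))).hom.hom.hom 2 (complexBetti.map e.ι 2 a)) δ)
    (hne : δ ≠ 1) :
    ¬ IsHyperbolicWeilType (T.prod T)
        (AbelianVariety.prodLift (AbelianVariety.fst T T ≫ φ) (AbelianVariety.snd T T ≫ (-φ))) (2 * j + 2)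
        ((d : ℂ) • complexBetti.map e.ι 2 a +
          complexBetti.map (AbelianVariety.prodLift (AbelianVariety.fst T T ≫ φ)
            (AbelianVariety.snd T T ≫ (-φ))).hom.hom.hom 2 (complexBetti.map e.ι 2 a)) := by
  refine not_isHyperbolicWeilType_of_hasWeilDiscriminantNondeg_ne (by omega) (dim_twistedSquare hT) hd (twistedSquare_comp_self hφ)
    e ha ha0 hδ ?_
  rwa [weilNormResidueGroup_mk_neg_one_pow_even]

end Even

/-! ## §3 Every twisted square is absolutely split -/

section AllDimensions

variable {T : AbelianVariety ℂ} {g d : ℕ} {φ : T ⟶ T}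

/-- **EVERY TWISTED SQUARE `(T × T, φ × (−φ))` WITH `dim T ≥ 2` IS OF SPLIT WEIL TYPE** in the absolute convention of the tree's ladder
(`IsSplitWeilType`): `dim T` even — §2 (the weight-`1` product class is hyperbolic); `dim T` odd — part O-e (ab-weil-2's factorwise rescaling).
[cite: vanGeemen1994HodgeAV, Lemma 5.2 (3), 5.4 and (5.4.1)] [cite: Landherr1936HermitianForms] [cite: Markman2025SurveySecant, §11.5 Step 1] -/
theorem isSplitWeilType_twistedSquare_of_two_le_dim (hg : 2 ≤ g) (hT : T.dim = g) (hd : 0 < d) (hφ : φ ≫ φ = -(d • 𝟙 T)) :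
    IsSplitWeilType (T.prod T)
      (AbelianVariety.prodLift (AbelianVariety.fst T T ≫ φ) (AbelianVariety.snd T T ≫ (-φ))) g d := by
  obtain ⟨r, hr | hr⟩ := Nat.even_or_odd' g
  · obtain ⟨j, rfl⟩ : ∃ j, g = 2 * j + 2 := ⟨r - 1, by omega⟩
    exact isSplitWeilType_twistedSquare_of_even hT hd hφ
  · subst hr
    exact isSplitWeilType_twistedSquare_of_odd (k := r) (by omega) hT hd hφ

/-- … hence **NO twisted square `T × T̄` (`dim T ≥ 2`) is of non-split Weil type in the absolute convention**: the hypothesis of the ladder's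
rung `NonsplitSixfolds` (`IsNonsplitWeilType`-shape: no hyperbolic `K`-symmetrised hyperplane class at all) fails at every anchor of this axis,
in every dimension. [cite: vanGeemen1994HodgeAV, Lemma 5.2 (3) and (5.4.1)] -/
theorem not_isNonsplitWeilType_twistedSquare (hg : 2 ≤ g) (hT : T.dim = g) (hd : 0 < d) (hφ : φ ≫ φ = -(d • 𝟙 T)) :
    ¬ IsNonsplitWeilType (T.prod T)
      (AbelianVariety.prodLift (AbelianVariety.fst T T ≫ φ) (AbelianVariety.snd T T ≫ (-φ))) g d :=
  (isSplitWeilType_twistedSquare_of_two_le_dim hg hT hd hφ).not_isNonsplitWeilType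

end AllDimensions

/-! ## §4 The split rungs hold at the anchors -/

section Rungs

variable {T : AbelianVariety ℂ} {d : ℕ} {φ : T ⟶ T}

/-- **THE BODY OF THE RUNG `SplitEightfolds` HOLDS AT `A × Ā` FOR EVERY ABELIAN FOURFOLD `A` WITH `K`-MULTIPLICATION** (any signature of `φ^*`
on `H^{1,0}(A)`): for every `K`-symmetrised hyperplane class for which `(A × A, φ × (−φ))` is hyperbolic — by §2 the product classes ARE — every
rational `(4,4)` Weil class is algebraic. The hyperbolicity hypothesis is not used: the Weil plane of a twisted square is algebraic outright
(the tree's `weilClassesOf_twistedSquare_le_algebraicClasses`, Schoen's graph argument). A sub-locus of the rung, not the rung.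
[cite: Schoen1998HodgeWeilAddendum, §10] [cite: Markman2025SecantWeil, §1.2] [cite: vanGeemen1994HodgeAV, 4.9 and 5.4] -/
theorem splitEightfolds_body_twistedSquare (hT : T.dim = 4) (hd : 0 < d) (hφ : φ ≫ φ = -(d • 𝟙 T))
    (e : ProjectiveEmbedding (T.prod T).X) (a : complexBetti (projectiveSpace e.n ℂ) 2) (_ha : IsRationalClass a) (_ha0 : a ≠ 0)
    (_hhyp : IsHyperbolicWeilType (T.prod T)
      (AbelianVariety.prodLift (AbelianVariety.fst T T ≫ φ) (AbelianVariety.snd T T ≫ (-φ))) 4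
      ((d : ℂ) • complexBetti.map e.ι 2 a +
        complexBetti.map (AbelianVariety.prodLift (AbelianVariety.fst T T ≫ φ)
          (AbelianVariety.snd T T ≫ (-φ))).hom.hom.hom 2 (complexBetti.map e.ι 2 a)))
    (c : complexBetti (T.prod T).X (2 * 4)) (_hc : IsRationalClass c)
    (_hH : IsOfHodgeType (2 * 4) (T.prod T).X (2 * 4) 4 4 c)
    (hcw : c ∈ weilClassesOf (T.prod T)
      (AbelianVariety.prodLift (AbelianVariety.fst T T ≫ φ) (AbelianVariety.snd T T ≫ (-φ))) 4 d) :
    c ∈ algebraicClasses (T.prod T).X 4 :=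
  weilClassesOf_twistedSquare_le_algebraicClasses (by norm_num) hT hd hφ hcw

/-- **The body of the rung `SplitWeilAbelianVarieties` (R2) holds at every twisted square `T × T̄`** (`dim T = n ≥ 1`; the rung asks `n ≥ 4`):
the Weil classes are algebraic whatever the `K`-symmetrised hyperplane class. [cite: Schoen1998HodgeWeilAddendum, §10] [cite: Markman2025SurveySecant, §12]
[cite: vanGeemen1994HodgeAV, 4.9] -/
theorem splitWeilAbelianVarieties_body_twistedSquare {n : ℕ} (hn : 0 < n) (hT : T.dim = n) (hd : 0 < d) (hφ : φ ≫ φ = -(d • 𝟙 T))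
    (e : ProjectiveEmbedding (T.prod T).X) (a : complexBetti (projectiveSpace e.n ℂ) 2) (_ha : IsRationalClass a) (_ha0 : a ≠ 0)
    (_hhyp : IsHyperbolicWeilType (T.prod T)
      (AbelianVariety.prodLift (AbelianVariety.fst T T ≫ φ) (AbelianVariety.snd T T ≫ (-φ))) n
      ((d : ℂ) • complexBetti.map e.ι 2 a +
        complexBetti.map (AbelianVariety.prodLift (AbelianVariety.fst T T ≫ φ)
          (AbelianVariety.snd T T ≫ (-φ))).hom.hom.hom 2 (complexBetti.map e.ι 2 a)))
    (c : complexBetti (T.prod T).X (2 * n)) (_hc : IsRationalClass c)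
    (_hH : IsOfHodgeType (2 * n) (T.prod T).X (2 * n) n n c)
    (hcw : c ∈ weilClassesOf (T.prod T)
      (AbelianVariety.prodLift (AbelianVariety.fst T T ≫ φ) (AbelianVariety.snd T T ≫ (-φ))) n d) :
    c ∈ algebraicClasses (T.prod T).X n :=
  weilClassesOf_twistedSquare_le_algebraicClasses hn hT hd hφ hcw

end Rungs

/-! ## §5 Hypothesis-free: a hyperbolic polarized Weil variety satisfying the Hodge conjecture in every `(2j+2, d, 1)` -/

section Inhabitants

/-- **EVERY SPLIT COMPONENT OF EVEN HALF-DIMENSION CONTAINS A POLARIZED HYPERBOLIC WEIL VARIETY SATISFYING THE HODGE CONJECTURE OUTRIGHT**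
(`d ≥ 1`, any `j`; hypothesis-free): the twisted square `E₀^{2j+2} × Ē₀^{2j+2}` of a power of the CM curve `ℂ/(ℤ + ℤ√−d)` (part O-d's
`exists_ellipticPower_sq_eq_neg`) with the weight-`1` product polarization — `dim A = 2(2j+2)`, `φ² = −d`, Weil type `(2j+2, d)`, discriminant class
`1`, HYPERBOLIC for the class (§2), algebraic Weil plane, and `HodgeConjectureFor A` in every codimension (Deligne's
`hodgeConjectureFor_powSucc_powSucc`: `A = (E₀.powSucc (2j+1)).powSucc 1`). The even companion of part O-d's non-split inhabitants.
[cite: vanGeemen1994HodgeAV, 4.14, 5.3–5.4 and Thm. 4.3] [cite: Deligne1982HodgeCycles, §4 Prop. 4.4 and Remark 4.10] [cite: Landherr1936HermitianForms] -/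
theorem exists_hodge_hyperbolic_weilVariety_even (j d : ℕ) (hd : 0 < d) :
    ∃ (A : AbelianVariety ℂ) (φ : A ⟶ A) (e : ProjectiveEmbedding A.X) (a : complexBetti (projectiveSpace e.n ℂ) 2),
      IsRationalClass a ∧ a ≠ 0 ∧ A.dim = 2 * (2 * j + 2) ∧ φ ≫ φ = -(d • 𝟙 A) ∧ IsWeilType A φ (2 * j + 2) d ∧
      HasWeilDiscriminantNondeg A φ (2 * j + 2) d
        ((d : ℂ) • complexBetti.map e.ι 2 a + complexBetti.map φ.hom.hom.hom 2 (complexBetti.map e.ι 2 a)) 1 ∧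
      IsHyperbolicWeilType A φ (2 * j + 2)
        ((d : ℂ) • complexBetti.map e.ι 2 a + complexBetti.map φ.hom.hom.hom 2 (complexBetti.map e.ι 2 a)) ∧
      weilClassesOf A φ (2 * j + 2) d ≤ algebraicClasses A.X (2 * j + 2) ∧ HodgeConjectureFor A.dim A.X := by
  obtain ⟨E₀, φT, hE, hT, hφT⟩ := exists_ellipticPower_sq_eq_neg d hd (2 * j + 1)
  have hT' : (E₀.powSucc (2 * j + 1)).dim = 2 * j + 2 := by rw [hT]
  obtain ⟨eT, aT, -, -, hemb⟩ := exists_hyperbolic_polarized_twistedSquare_of_even hT' hd hφT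
  obtain ⟨e, a, ha, ha0, -, hδ, -, hhyp⟩ := hemb 1 one_pos
  exact ⟨_, _, e, a, ha, ha0, dim_twistedSquare hT', twistedSquare_comp_self hφT, isWeilType_twistedSquare (by omega) hT' hd hφT, hδ,
    hhyp, weilClassesOf_twistedSquare_le_algebraicClasses (by omega) hT' hd hφT, Deligne1982.hodgeConjectureFor_powSucc_powSucc hE (2 * j + 1) 1⟩

end Inhabitants

end Summit.HodgeConjecture.HodgeConjecture.Ring2.AbelianAll

end
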